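import Summits.RiemannHypothesis.RiemannHypothesis.Theorems.JensenPolynomialsSkeletonMargin
import Literature.NumberTheory.LFunctions.XiToeplitzCubicWedge

/-!
# Route `JensenPolynomials` — rung J-P (P1⁺) for `γ = xiTaylorCoeff`: the window sequence in MOMENT form and the parameter
# range `0 < κ_n² ≤ 1` of the skeleton

**RH-FREE.** For the Taylor data `γ = xiTaylorCoeff` of `ξ` (`γ(n)·(½)_n = 64·M_{2n}`, `M_k = ∫₀^∞ Φ(u)u^k du`, tree
`xiTaylorCoeff_ratio_skeleton`) and `b = n + ½`:

* `windowSeq_xi_eq_moments` — the **tilted-moment dictionary of the window**: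
  `r_n(j) = (b^j/(b)_j) · M_{2n+2j}·M_{2n}^{j−1}/M_{2n+2}^j`, i.e. the window sequence is the Bessel weight `b^j/(b)_j` times the
  normalised moment sequence of the tilted measure `u^{2n}Φ(u)du` (units `m₀ = m₁ = 1`); the skeleton replaces the latter by
  `κ_n^j·(tilt)` — the structural heart of the CAL (ALPHA-DISC §0 (i)).
* `le_windowSeq_xi_two`, `skelKappaSq_xi_le_one` — `r_n(2) ≥ b/(b+1)` by Cauchy–Schwarz log-convexity of the moments (tree
  `xiMoment_sq_le_mul`, Michałowski's Lemma 2.1 upper bound), hence **`κ_n² = (b+1)(1 − r_n(2)) ≤ 1`**; with `skelKappaSq_xi_pos`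
  (strict Turán) the skeleton's Bessel parameter satisfies `0 < κ_n ≤ 1` and its tilt `0 ≤ θ_n < 1` for EVERY shift `n`
  (`skelKappa_xi_le_one`, `skelTheta_xi_nonneg`, `skelTheta_xi_lt_one`). DATA (ET7 §6 (g)): `κ²(n) = 0.104 (n = 0) … 0.803
  (n = 134 980)`, inside `(0, 1]` as it must be.

WHAT THIS IS NOT: parameter bookkeeping only; no cell of the sign test is proved; nothing here bears on the truth of RH.
-/

noncomputable section
-- D-0017: `Summit.RiemannHypothesis.RiemannHypothesis.…` duplicates the namespace BY DESIGN (single-problem summit).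
set_option linter.dupNamespace false

namespace Summit.RiemannHypothesis.RiemannHypothesis.Theorems.JensenPolynomials

open Literature.NumberTheory.LFunctions Polynomial Finset
open scoped BigOperators Nat

/-- `γ(n+j) = γ(n)·M_{2n+2j}/((b)_j·M_{2n})`, `b = n + ½` (tree `xiTaylorCoeff_ratio_skeleton`, solved for `γ(n+j)`). -/
theorem xiTaylorCoeff_add_eq_moments (n j : ℕ) :
    xiTaylorCoeff (n + j) = xiTaylorCoeff n * xiMoment (2 * (n + j)) /
      ((ascPochhammer ℝ j).eval ((n : ℝ) + 1 / 2) * xiMoment (2 * n)) := by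
  have h := xiTaylorCoeff_ratio_skeleton n j
  have hp : 0 < (ascPochhammer ℝ j).eval ((n : ℝ) + 1 / 2) := ascPochhammer_pos _ _ (by positivity)
  have hM : 0 < xiMoment (2 * n) := xiMoment_pos _
  rw [eq_div_iff (mul_pos hp hM).ne', ← h]
  ring

/-- **Tilted-moment dictionary of the window** (RH-FREE): for `γ = xiTaylorCoeff`, `b = n + ½` and every `j`,
`r_n(j) = (b^j/(b)_j) · (M_{2n+2j}·M_{2n}^j)/(M_{2n}·M_{2n+2}^j)`. -/
theorem windowSeq_xi_eq_moments (n j : ℕ) :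
    windowSeq xiTaylorCoeff n j = ((n : ℝ) + 1 / 2) ^ j / (ascPochhammer ℝ j).eval ((n : ℝ) + 1 / 2) *
      (xiMoment (2 * (n + j)) * xiMoment (2 * n) ^ j / (xiMoment (2 * n) * xiMoment (2 * (n + 1)) ^ j)) := by
  have hγ : 0 < xiTaylorCoeff n := xiTaylorCoeff_pos_holds n
  have hp : 0 < (ascPochhammer ℝ j).eval ((n : ℝ) + 1 / 2) := ascPochhammer_pos _ _ (by positivity)
  have hp1 : (ascPochhammer ℝ 1).eval ((n : ℝ) + 1 / 2) = (n : ℝ) + 1 / 2 := by rw [ascPochhammer_one, eval_X]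
  have hM0 : 0 < xiMoment (2 * n) := xiMoment_pos _
  have hM1 : 0 < xiMoment (2 * (n + 1)) := xiMoment_pos _
  have hb : (0 : ℝ) < (n : ℝ) + 1 / 2 := by positivity
  -- pure algebra on atoms
  have aux : ∀ (g b P M0 M1 Mj : ℝ), g ≠ 0 → b ≠ 0 → P ≠ 0 → M0 ≠ 0 → M1 ≠ 0 →
      g * Mj / (P * M0) * g ^ j / (g * (g * M1 / (b * M0)) ^ j) = b ^ j / P * (Mj * M0 ^ j / (M0 * M1 ^ j)) := by
    intro g b P M0 M1 Mj hg hb' hP hM0' hM1'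
    rw [div_pow, mul_pow, mul_pow]
    field_simp
  have h1 : xiTaylorCoeff (n + 1) = xiTaylorCoeff n * xiMoment (2 * (n + 1)) / (((n : ℝ) + 1 / 2) * xiMoment (2 * n)) := by
    rw [xiTaylorCoeff_add_eq_moments n 1, hp1]
  rw [windowSeq, xiTaylorCoeff_add_eq_moments n j, h1]
  exact aux _ _ _ _ _ _ hγ.ne' hb.ne' hp.ne' hM0.ne' hM1.ne'

/-- **Cauchy–Schwarz lower bound for `r_n(2)`** (RH-FREE): `b/(b+1) ≤ r_n(2)`, `b = n + ½`, for `γ = xiTaylorCoeff` — from the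
log-convexity `M_{2n+2}² ≤ M_{2n}·M_{2n+4}` of the moments of `Φ` (tree `xiMoment_sq_le_mul`). -/
theorem le_windowSeq_xi_two (n : ℕ) :
    ((n : ℝ) + 1 / 2) / ((n : ℝ) + 3 / 2) ≤ windowSeq xiTaylorCoeff n 2 := by
  have hM0 : 0 < xiMoment (2 * n) := xiMoment_pos _
  have hM1 : 0 < xiMoment (2 * (n + 1)) := xiMoment_pos _
  have hb : (0 : ℝ) < (n : ℝ) + 1 / 2 := by positivity
  have hcs : xiMoment (2 * (n + 1)) ^ 2 ≤ xiMoment (2 * n) * xiMoment (2 * (n + 2)) := by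
    have h := xiMoment_sq_le_mul (2 * n)
    rwa [show 2 * n + 2 = 2 * (n + 1) by ring, show 2 * n + 4 = 2 * (n + 2) by ring] at h
  have hp2 : (ascPochhammer ℝ 2).eval ((n : ℝ) + 1 / 2) = ((n : ℝ) + 1 / 2) * ((n : ℝ) + 3 / 2) := by
    rw [ascPochhammer_succ_eval, ascPochhammer_one, eval_X]
    push_cast
    ring
  rw [windowSeq_xi_eq_moments, hp2, div_le_iff₀ (by positivity)]
  rw [show ((n : ℝ) + 1 / 2) ^ 2 / (((n : ℝ) + 1 / 2) * ((n : ℝ) + 3 / 2)) *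
      (xiMoment (2 * (n + 2)) * xiMoment (2 * n) ^ 2 / (xiMoment (2 * n) * xiMoment (2 * (n + 1)) ^ 2)) *
      ((n : ℝ) + 3 / 2) = ((n : ℝ) + 1 / 2) * ((xiMoment (2 * n) * xiMoment (2 * (n + 2))) /
        xiMoment (2 * (n + 1)) ^ 2) by field_simp]
  have h1 : 1 ≤ xiMoment (2 * n) * xiMoment (2 * (n + 2)) / xiMoment (2 * (n + 1)) ^ 2 := by
    rw [le_div_iff₀ (by positivity), one_mul]
    exact hcs
  nlinarith

/-- **`κ_n² ≤ 1` for `γ = xiTaylorCoeff`, every `n`** (RH-FREE): `κ_n² = (b+1)(1 − r_n(2)) ≤ (b+1)(1 − b/(b+1)) = 1`. Together with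
`skelKappaSq_xi_pos`: `0 < κ_n² ≤ 1`. -/
theorem skelKappaSq_xi_le_one (n : ℕ) : skelKappaSq xiTaylorCoeff n ≤ 1 := by
  have h := le_windowSeq_xi_two n
  have hb1 : (0 : ℝ) < (n : ℝ) + 3 / 2 := by positivity
  rw [skelKappaSq]
  have h2 : ((n : ℝ) + 3 / 2) * (1 - windowSeq xiTaylorCoeff n 2) ≤
      ((n : ℝ) + 3 / 2) * (1 - ((n : ℝ) + 1 / 2) / ((n : ℝ) + 3 / 2)) :=
    mul_le_mul_of_nonneg_left (by linarith) hb1.le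
  have h3 : ((n : ℝ) + 3 / 2) * (1 - ((n : ℝ) + 1 / 2) / ((n : ℝ) + 3 / 2)) = 1 := by
    field_simp
    ring
  linarith

/-- `0 < κ_n ≤ 1` for `γ = xiTaylorCoeff` (upper half). RH-FREE. -/
theorem skelKappa_xi_le_one (n : ℕ) : skelKappa xiTaylorCoeff n ≤ 1 := by
  rw [skelKappa, ← Real.sqrt_one]
  exact Real.sqrt_le_sqrt (skelKappaSq_xi_le_one n)

/-- The tilt of the skeleton of `ξ` is non-negative: `0 ≤ θ_n = 1 − κ_n`. RH-FREE. -/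
theorem skelTheta_xi_nonneg (n : ℕ) : 0 ≤ skelTheta xiTaylorCoeff n := by
  rw [skelTheta]
  linarith [skelKappa_xi_le_one n]

/-- The tilt of the skeleton of `ξ` is `< 1`: `θ_n = 1 − κ_n < 1` (`κ_n > 0`, strict Turán). RH-FREE. -/
theorem skelTheta_xi_lt_one (n : ℕ) : skelTheta xiTaylorCoeff n < 1 := by
  rw [skelTheta]
  linarith [skelKappa_xi_pos n]

end Summit.RiemannHypothesis.RiemannHypothesis.Theorems.JensenPolynomials

end
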